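import Summits.CriticalPhenomena.PercolationContinuityZ3.Theorems.Transplant.BccClawXStack
import Summits.CriticalPhenomena.PercolationContinuityZ3.Theorems.Transplant.BccSlabZig
import HarnessLib

/-!
# The bcc (001)-slabs, exit-form routing certificate VIII: the KIT for the 3D template of the exceptional (stacked) configurations — frame vertices,
# explicit frame paths, monotone connectors, and the assembly of one routing

builds on p205010 (kernel theorem, internal audit signed; external expert review pending) — NOT used in this file.
Lane `prim-bschramm`, seat `prim-bschramm-p2` (gen 46; class C1b, METHOD = input substitution; memo `HOME/bschramm/P2-LATTICES.md` §156); helper file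
(`--supports stmt-CriticalPhenomena-4575 --as helper`).
In a frame `(A; μ, ν)` («BccClawXStack».`Frame`: the `2 × 3` patch of columns `fcol A μ ν i j = A + i μ + j ν`, `i ≤ 1`, `j ≤ 2`, inside the rerouting
region) the stacked template («BccSlabStackedRoute*») writes its chains and branches as EXPLICIT vertex lists.  This file provides:
* §1 the frame vertices `fv k A μ ν i j h = vtx (fcol A μ ν i j) h`, their admissibility (`Frame.adm`: parity `i + j`), adjacency (`Frame.fv_adj`) and
  injectivity (`Frame.fv_inj`);
* §2 explicit frame paths `fpath` from lists of `(i, j, h)` triples: **`Frame.gpath_fpath`** (a self-avoiding slab path as soon as the triples are admissible,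
  pairwise distinct and consecutive ones adjacent), membership (`mem_fpath`);
* §3 **`Frame.exists_mono`**: a monotone zigzag connector between two vertices over a pair of adjacent frame columns, with column and height control;
* §4 **`VRouteData.ofPaths'`**: «VPathKit».`VRouteData.ofPaths` with the interior condition stated on the whole chain.
[cite: DuminilCopinSidoraviciusTassion2016, §2.3 (proof of Fact 2: the three disjoint paths)] [cite: ConwaySloane1999, Ch. 4 §7.1]
-/

noncomputable section

namespace Summit.CriticalPhenomena.PercolationContinuityZ3.Theorems.Transplant

/-! ## §4 (first, it is graph theory) One routing from two paths, interior condition on the whole chain -/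

namespace VRouteData

variable {V : Type} {G : SimpleGraph V} {WR W : Set V}

/-- «VPathKit».`VRouteData.ofPaths` with `∀ x ∈ SP, x ∈ W_R` in place of the interior condition. [folklore] -/
theorem exists_ofPaths' {E₁ E₂ w' c y b : V} {SP Br : List V} (hSP : GPath G SP E₁ E₂) (hne : E₁ ≠ E₂) (hall : ∀ x ∈ SP, x ∈ WR)
    (hcy : ∃ l₁ l₂ : List V, SP = l₁ ++ c :: y :: l₂) (hBr : GPath G Br b w') (hBrW : ∀ x ∈ Br, x ∈ W) (hcb : G.Adj c b)
    (hoff : ∀ x ∈ Br, x ∉ SP) : ∃ r : VRouteData G WR W E₁ E₂ w', r.y = y ∧ r.b = b :=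
  ⟨ofPaths hSP hne (fun x hx => hall x (List.tail_subset SP (List.dropLast_subset _ hx))) hcy hBr hBrW hcb hoff, ofPaths_y _ _ _ _ _ _ _ _,
    ofPaths_b _ _ _ _ _ _ _ _⟩

end VRouteData

namespace BccSlab

open Literature.Probability.Percolation Literature.Probability.LatticeModels SimpleGraph
open BccClawX
open scoped Classical

variable {k : ℕ}

/-! ## §1 Frame vertices -/

/-- **The frame vertex** over the frame column `(i, j)` at height `h`. [folklore] -/
def fv (k : ℕ) (A : Site 2) (μ ν : Pt) (i j h : ℤ) : bslab k := vtx k (fcol A μ ν i j) h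

/-- Coordinate sum of a frame column. [folklore] -/
theorem fcol_sum (A : Site 2) (μ ν : Pt) (i j : ℤ) : (fcol A μ ν i j) 0 + (fcol A μ ν i j) 1 = A 0 + A 1 + i * (μ.1 + μ.2) + j * (ν.1 + ν.2) := by
  simp only [fcol, Pi.add_apply, vec_apply_zero, vec_apply_one]; ring

/-- A unit vector has coordinate sum `±1`. [folklore] -/
theorem unit_sum {μ : Pt} (h : μ ∈ units) : μ.1 + μ.2 = 1 ∨ μ.1 + μ.2 = -1 := by
  rcases mem_units_iff.1 h with rfl | rfl | rfl | rfl <;> simp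

/-- Shadow of an admissible frame vertex. [folklore] -/
theorem sh_fv {A : Site 2} {μ ν : Pt} {i j h : ℤ} (ha : Adm k (fcol A μ ν i j) h) : sh (fv k A μ ν i j h) = fcol A μ ν i j := sh_vtx ha

/-- Height of an admissible frame vertex. [folklore] -/
theorem ht_fv {A : Site 2} {μ ν : Pt} {i j h : ℤ} (ha : Adm k (fcol A μ ν i j) h) : ht (fv k A μ ν i j h) = h := ht_vtx ha

/-- The frame path of a list of `(i, j, h)` triples. [folklore] -/
def fpath (k : ℕ) (A : Site 2) (μ ν : Pt) (ts : List (ℤ × ℤ × ℤ)) : List (bslab k) := ts.map fun t => fv k A μ ν t.1 t.2.1 t.2.2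

/-- Membership in a frame path. [folklore] -/
theorem mem_fpath {A : Site 2} {μ ν : Pt} {ts : List (ℤ × ℤ × ℤ)} {x : bslab k} :
    x ∈ fpath k A μ ν ts ↔ ∃ t ∈ ts, x = fv k A μ ν t.1 t.2.1 t.2.2 := by
  simp only [fpath, List.mem_map]
  constructor
  · rintro ⟨t, ht, rfl⟩; exact ⟨t, ht, rfl⟩
  · rintro ⟨t, ht, rfl⟩; exact ⟨t, ht, rfl⟩

/-- The step relation on triples: one unit in one coefficient slot, one unit in height. [folklore] -/
def Step (t t' : ℤ × ℤ × ℤ) : Prop :=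
  ((t'.1 = t.1 ∧ (t'.2.1 = t.2.1 + 1 ∨ t.2.1 = t'.2.1 + 1)) ∨ (t'.2.1 = t.2.1 ∧ (t'.1 = t.1 + 1 ∨ t.1 = t'.1 + 1))) ∧
    (t'.2.2 = t.2.2 + 1 ∨ t'.2.2 = t.2.2 - 1)

/-- Mapping a chain along a relation-respecting function, using membership. [folklore] -/
theorem isChain_map_of_mem {α β : Type} {R : α → α → Prop} {S : β → β → Prop} {f : α → β} :
    ∀ {l : List α}, (∀ a ∈ l, ∀ b ∈ l, R a b → S (f a) (f b)) → l.IsChain R → (l.map f).IsChain S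
  | [], _, _ => List.IsChain.nil
  | [a], _, _ => List.IsChain.singleton _
  | a :: b :: l, h, hc => by
    rw [List.map_cons, List.map_cons, List.isChain_cons_cons]
    rw [List.isChain_cons_cons] at hc
    refine ⟨h a (by simp) b (by simp) hc.1, ?_⟩
    have := isChain_map_of_mem (l := b :: l) (fun x hx y hy hxy => h x (List.mem_cons_of_mem _ hx) y (List.mem_cons_of_mem _ hy) hxy) hc.2
    rwa [List.map_cons] at this

end BccSlab

namespace BccClawX

namespace Frame

open Literature.Probability.Percolation Literature.Probability.LatticeModels SimpleGraph BccSlab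
open scoped Classical

variable {k : ℕ} {RP : Set (Site 2)} {A : Site 2} {μ ν : Pt} (F : Frame RP A μ ν)
include F

/-- Adjacent coefficient pairs give lattice-adjacent frame columns. [folklore] -/
theorem fcol_adj {i j i' j' : ℤ} (hc : (i' = i ∧ (j' = j + 1 ∨ j = j' + 1)) ∨ (j' = j ∧ (i' = i + 1 ∨ i = i' + 1))) :
    (zdGraph 2).Adj (fcol A μ ν i j) (fcol A μ ν i' j') := by
  rcases hc with ⟨hi, hj | hj⟩ | ⟨hj, hi | hi⟩
  · rw [hi, hj]; exact F.adj_j i j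
  · rw [hi, hj]; exact (F.adj_j i j').symm
  · rw [hj, hi]; have := adj_add_vec F.hμ (fcol A μ ν i j); rwa [← fcol_succ_i] at this
  · rw [hj, hi]; have := adj_add_vec F.hμ (fcol A μ ν i' j); rw [← fcol_succ_i] at this; exact this.symm

/-- **Admissibility of frame vertices**: `(fcol i j, h)` is admissible iff `h ≡ h₀ + i + j (mod 2)` for an admissible `(A, h₀)`, `0 ≤ h ≤ k`. [folklore] -/
theorem adm {h₀ : ℤ} (hA : Adm k A h₀) {i j h : ℤ} (hpar : Even (i + j + (h - h₀))) (h0 : 0 ≤ h) (hk : h ≤ k) : Adm k (fcol A μ ν i j) h := by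
  refine ⟨h0, hk, ?_⟩
  obtain ⟨m, hm⟩ := hA.2.2
  obtain ⟨n, hn⟩ := hpar
  rw [fcol_sum]
  rcases unit_sum F.hμ with e | e <;> rcases unit_sum F.hν with e' | e' <;> rw [e, e']
  · exact ⟨m + n - (h - h₀), by omega⟩
  · exact ⟨m + n - j - (h - h₀), by omega⟩
  · exact ⟨m + n - i - (h - h₀), by omega⟩
  · exact ⟨m - n, by omega⟩

/-- **Injectivity of frame vertices** (admissible ones): equal vertices have equal coefficients and heights. [folklore] -/
theorem fv_inj {i j h i' j' h' : ℤ} (ha : Adm k (fcol A μ ν i j) h) (ha' : Adm k (fcol A μ ν i' j') h')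
    (e : fv k A μ ν i j h = fv k A μ ν i' j' h') : i = i' ∧ j = j' ∧ h = h' := by
  obtain ⟨hc, hh⟩ := (vtx_eq_vtx_iff ha ha').1 e
  obtain ⟨hi, hj⟩ := fcol_inj F.hμ F.hν F.hperp hc
  exact ⟨hi, hj, hh⟩

/-- **Adjacency of frame vertices**: coefficients differing by one unit in one slot, heights by one. [folklore] -/
theorem fv_adj {i j h i' j' h' : ℤ} (ha : Adm k (fcol A μ ν i j) h) (ha' : Adm k (fcol A μ ν i' j') h')
    (hc : (i' = i ∧ (j' = j + 1 ∨ j = j' + 1)) ∨ (j' = j ∧ (i' = i + 1 ∨ i = i' + 1))) (hh : h' = h + 1 ∨ h' = h - 1) :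
    (slabGraph k).Adj (fv k A μ ν i j h) (fv k A μ ν i' j' h') := by
  exact adj_vtx ha ha' (F.fcol_adj hc) hh

/-! ## §2 Explicit frame paths -/

/-- **A frame path is a self-avoiding slab path** when its triples are admissible, pairwise distinct, and consecutive ones make a `Step`. [folklore] -/
theorem gpath_fpath {ts : List (ℤ × ℤ × ℤ)} (hne : ts ≠ []) (hadm : ∀ t ∈ ts, Adm k (fcol A μ ν t.1 t.2.1) t.2.2) (hnd : ts.Nodup)
    (hch : ts.IsChain Step) :
    GPath (slabGraph k) (fpath k A μ ν ts) ((fun t => fv k A μ ν t.1 t.2.1 t.2.2) (ts.head hne)) ((fun t => fv k A μ ν t.1 t.2.1 t.2.2) (ts.getLast hne)) := by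
  have hne' : fpath k A μ ν ts ≠ [] := by simpa [fpath] using hne
  refine ⟨hne', ?_, ?_, ?_, ?_⟩
  · exact isChain_map_of_mem (fun a ha b hb hab => F.fv_adj (hadm a ha) (hadm b hb) hab.1 hab.2) hch
  · rw [fpath]
    refine hnd.map_on fun a ha b hb hab => ?_
    obtain ⟨h1, h2, h3⟩ := F.fv_inj (hadm a ha) (hadm b hb) hab
    exact Prod.ext h1 (Prod.ext h2 h3)
  · rw [fpath, List.head?_map, List.head?_eq_some_head hne]; rfl
  · rw [fpath, List.getLast?_map, List.getLast?_eq_some_getLast hne]; rfl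

omit F in
/-- Columns and heights on a frame path. [folklore] -/
theorem sh_ht_of_mem_fpath {ts : List (ℤ × ℤ × ℤ)} (hadm : ∀ t ∈ ts, Adm k (fcol A μ ν t.1 t.2.1) t.2.2) {x : bslab k} (hx : x ∈ fpath k A μ ν ts) :
    ∃ t ∈ ts, sh x = fcol A μ ν t.1 t.2.1 ∧ ht x = t.2.2 := by
  obtain ⟨t, ht, rfl⟩ := mem_fpath.1 hx
  exact ⟨t, ht, sh_fv (hadm t ht), ht_fv (hadm t ht)⟩

/-! ## §3 Monotone connectors over a pair of adjacent frame columns -/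

/-- **THE MONOTONE CONNECTOR**: from the frame vertex `(i, j, t₀)` to the frame vertex `(i', j', t₁)` over an adjacent column pair `{(i,j), (i',j')}` or the
same column, a self-avoiding slab path all of whose vertices lie over the two columns with heights between `t₀` and `t₁` (a zigzag of «BccSlabZig», or a
single vertex). [cite: DuminilCopinSidoraviciusTassion2016, §2.3 (proof of Fact 2)] -/
theorem exists_mono {i j i' j' : ℤ} (hc : (i' = i ∧ (j' = j + 1 ∨ j = j' + 1)) ∨ (j' = j ∧ (i' = i + 1 ∨ i = i' + 1))) {t₀ t₁ : ℤ}
    (ha₀ : Adm k (fcol A μ ν i j) t₀) {p q : ℤ} (htgt : (p = i ∧ q = j) ∨ (p = i' ∧ q = j')) (ha₁ : Adm k (fcol A μ ν p q) t₁) :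
    ∃ L : List (bslab k), GPath (slabGraph k) L (fv k A μ ν i j t₀) (fv k A μ ν p q t₁) ∧
      ∀ x ∈ L, (sh x = fcol A μ ν i j ∨ sh x = fcol A μ ν i' j') ∧ min t₀ t₁ ≤ ht x ∧ ht x ≤ max t₀ t₁ := by
  have hadj : (zdGraph 2).Adj (fcol A μ ν i j) (fcol A μ ν i' j') := F.fcol_adj hc
  -- parity of the end column relative to the height difference
  have hsum := sum_step_of_adj hadj
  obtain ⟨m₀, hm₀⟩ := ha₀.2.2
  obtain ⟨m₁, hm₁⟩ := ha₁.2.2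
  by_cases heq : t₀ = t₁
  · -- same height: same column, single vertex
    subst heq
    have hpq : p = i ∧ q = j := by
      rcases htgt with h | ⟨rfl, rfl⟩
      · exact h
      · exfalso; rcases hsum with e | e <;> omega
    obtain ⟨rfl, rfl⟩ := hpq
    refine ⟨[fv k A μ ν p q t₀], GPath.single _ _, fun x hx => ?_⟩
    rw [List.mem_singleton] at hx; subst hx
    rw [sh_fv ha₀, ht_fv ha₀]
    exact ⟨Or.inl rfl, min_le_left _ _, le_max_left _ _⟩
  · -- a zigzag of `n = |t₁ - t₀|` steps
    set σ : ℤ := if t₀ < t₁ then 1 else -1 with hσ'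
    have hσ : σ = 1 ∨ σ = -1 := by rw [hσ']; split_ifs <;> simp
    set n : ℕ := (|t₁ - t₀|).toNat with hn
    have hn' : (n : ℤ) = |t₁ - t₀| := by rw [hn, Int.toNat_of_nonneg (abs_nonneg _)]
    have hend : t₀ + σ * n = t₁ := by
      rw [hσ']; split_ifs with hlt
      · rw [one_mul, hn', abs_of_pos (sub_pos.2 hlt)]; ring
      · rw [neg_one_mul, hn', abs_of_nonpos (by omega)]; ring
    have hrange : 0 ≤ t₀ + σ * n ∧ t₀ + σ * n ≤ k := by rw [hend]; exact ⟨ha₁.1, ha₁.2.1⟩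
    have hG := gpath_zig (k := k) hσ hadj ha₀ hrange
    -- the end column is `(p, q)`
    have hcol : zcol (fcol A μ ν i j) (fcol A μ ν i' j') n = fcol A μ ν p q := by
      rcases Nat.even_or_odd n with ⟨m, hm⟩ | ⟨m, hm⟩
      · rw [hm, ← two_mul, zcol_two_mul]
        rcases htgt with ⟨rfl, rfl⟩ | ⟨rfl, rfl⟩
        · rfl
        · exfalso
          have : (n : ℤ) = 2 * m := by rw [hm]; push_cast; ring
          rcases hsum with e | e <;> rcases hσ with hs | hs <;> rw [hs] at hend <;> omega
      · rw [hm, zcol_two_mul_add_one]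
        rcases htgt with ⟨rfl, rfl⟩ | ⟨rfl, rfl⟩
        · exfalso
          have : (n : ℤ) = 2 * m + 1 := by rw [hm]; push_cast; ring
          rcases hσ with hs | hs <;> rw [hs] at hend <;> omega
        · rfl
    rw [hcol, hend] at hG
    refine ⟨_, hG, fun x hx => ?_⟩
    obtain ⟨hshx, l, hl, hhl⟩ := sh_ht_of_mem_zig hσ hadj ha₀ hrange hx
    have hl' : (l : ℤ) ≤ n := by exact_mod_cast hl
    refine ⟨hshx, ?_, ?_⟩
    · rw [min_le_iff]; rcases hσ with hs | hs <;> rw [hs] at hend hhl <;> omega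
    · rw [le_max_iff]; rcases hσ with hs | hs <;> rw [hs] at hend hhl <;> omega

end Frame

end BccClawX

end Summit.CriticalPhenomena.PercolationContinuityZ3.Theorems.Transplant

end
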